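import Summits.CriticalPhenomena.CardyFormulaZ2.Theorems.CardyMagicRigidityNestingRigidityNeckCoveringAChainT
import HarnessLib

/-!
# Crux `NestingRigidity`, line `pinch-resampling` (v4), stub S11: the crossing clusters of a node, read off the necklace

Crux `Summit.CriticalPhenomena.CardyFormulaZ2.Theses.CardyMagicRigidity.NestingRigidity` (stmt-CriticalPhenomena-4835),
line `pinch-resampling` v4, stub S11 `stub_neckHookupCoarseT : NeckHookupCoarseT`.  Worker W6c, wave 6.

In the summation of the necklace bound (amended plan of worker W6a, module docstring of `…GapEntropy`) the four-arm event
of a good node `Q` (sub-family `𝒩` of the virtual edges) must be certified by two SPECIFIC clusters of the necklace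
`Y₀ ∋ b, Y_e ∋ outP e` — the cluster `U_Q` just below the first rank of `𝒩` and the cluster `V_Q` at the end of the first
run of consecutive ranks inside `𝒩` — so that an arm lent by any OTHER necklace cluster is cluster-exempt for `Q`
(`real_tFourArm_and_armsIn_le`, `…NeckNodeReimerRegionT`).  This module reads that certificate off the necklace clauses of
`tCovering_A_chain` / `TNodeEventChainA`:

* §1 `NeckBridge.exists_firstRun` (pure finset combinatorics): the least rank `e₁` of `𝒩`, the end `eV` of the first run
  (all edges of `F` with rank in `[rk e₁, rk eV]` lie in `𝒩`), the rank-predecessor `eU ∉ 𝒩` of `e₁` (if any) and the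
  rank-successor `eS ∉ 𝒩` of `eV` (if any), with the consecutiveness side conditions of the necklace clauses.
* §2 `tChain_node_clusters` (registered anchor): under the necklace clauses, for every nonempty `𝒩 ⊆ F`, centre `w` and
  radii as in the node property, there are representatives `uU ∈ {b} ∪ outP (F ∖ 𝒩)` and `uV ∈ outP 𝒩`, NOT joined inside
  `Λ_{2s}(x)`, and two open crossings `p₁ → q₁`, `p₂ → q₂` of `tAnn w r R`, not joined inside the annulus, with `p₁` joined to
  `uU` and `p₂` to `uV` inside `Λ_{2s}(x)` (so a cluster of `Λ_{2s}(x)` containing neither `uU` nor `uV` contains neither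
  `p₁` nor `p₂`).
-/

noncomputable section

namespace Summit.CriticalPhenomena.CardyFormulaZ2.Cruxes.NestingRigidity.PinchResampling

open MeasureTheory Set Literature.Probability.Percolation Literature.Probability.LatticeModels

namespace NeckBridge

/-! ## §1 The first run of a sub-family -/

/-- **The first run of a sub-family.**  For `𝒩 ⊆ F` nonempty and a rank `rk` injective on `F`: the edge `e₁` of least
rank in `𝒩`, the last edge `eV ∈ 𝒩` of the first run (every edge of `F` with rank in `[rk e₁, rk eV]` is in `𝒩`), and —
unless `e₁` has least rank in `F` — its rank-predecessor `eU ∈ F ∖ 𝒩` (rank-consecutive with `e₁`), and — unless `eV` has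
largest rank in `F` — its rank-successor `eS ∈ F ∖ 𝒩` (rank-consecutive with `eV`). -/
theorem exists_firstRun {α : Type*} [DecidableEq α] {F 𝒩 : Finset α} (h𝒩 : 𝒩 ⊆ F) (hne : 𝒩.Nonempty) (rk : α → ℕ)
    (hinj : Set.InjOn rk ↑F) :
    ∃ e₁ ∈ 𝒩, ∃ eV ∈ 𝒩, rk e₁ ≤ rk eV ∧ (∀ e ∈ 𝒩, rk e₁ ≤ rk e) ∧
      (∀ e ∈ F, rk e₁ ≤ rk e → rk e ≤ rk eV → e ∈ 𝒩) ∧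
      ((∀ e ∈ F, rk e₁ ≤ rk e) ∨
        ∃ eU ∈ F, eU ∉ 𝒩 ∧ rk eU < rk e₁ ∧ ∀ e ∈ F, rk e ≤ rk eU ∨ rk e₁ ≤ rk e) ∧
      ((∀ e ∈ F, rk e ≤ rk eV) ∨
        ∃ eS ∈ F, eS ∉ 𝒩 ∧ rk eV < rk eS ∧ ∀ e ∈ F, rk e ≤ rk eV ∨ rk eS ≤ rk e) := by
  classical
  obtain ⟨e₁, he₁, hmin⟩ := 𝒩.exists_min_image rk hne
  -- the run: edges of `𝒩` below which (from `e₁` on) everything in `F` is in `𝒩`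
  set S := 𝒩.filter (fun e ↦ ∀ e' ∈ F, rk e₁ ≤ rk e' → rk e' ≤ rk e → e' ∈ 𝒩) with hS
  have he₁S : e₁ ∈ S := by
    refine Finset.mem_filter.2 ⟨he₁, fun e' he' h1 h2 ↦ ?_⟩
    have : rk e' = rk e₁ := le_antisymm h2 h1
    rw [hinj (Finset.mem_coe.2 he') (Finset.mem_coe.2 (h𝒩 he₁)) this]
    exact he₁
  obtain ⟨eV, heVS, hVmax⟩ := S.exists_max_image rk ⟨e₁, he₁S⟩
  obtain ⟨heV, hrun⟩ := Finset.mem_filter.1 heVS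
  have h1V : rk e₁ ≤ rk eV := hmin eV heV
  refine ⟨e₁, he₁, eV, heV, h1V, hmin, hrun, ?_, ?_⟩
  · -- predecessor of `e₁` in `F`
    by_cases hbot : ∀ e ∈ F, rk e₁ ≤ rk e
    · exact Or.inl hbot
    · right
      push Not at hbot
      set P := F.filter (fun e ↦ rk e < rk e₁) with hP
      have hPne : P.Nonempty := by
        obtain ⟨e, he, hlt⟩ := hbot
        exact ⟨e, Finset.mem_filter.2 ⟨he, hlt⟩⟩
      obtain ⟨eU, heUP, hUmax⟩ := P.exists_max_image rk hPne
      obtain ⟨heU, hUlt⟩ := Finset.mem_filter.1 heUP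
      refine ⟨eU, heU, fun hU𝒩 ↦ absurd (hmin eU hU𝒩) (not_le.2 hUlt), hUlt, fun e he ↦ ?_⟩
      by_cases h : rk e < rk e₁
      · exact Or.inl (hUmax e (Finset.mem_filter.2 ⟨he, h⟩))
      · exact Or.inr (not_lt.1 h)
  · -- successor of `eV` in `F`
    by_cases htop : ∀ e ∈ F, rk e ≤ rk eV
    · exact Or.inl htop
    · right
      push Not at htop
      set P := F.filter (fun e ↦ rk eV < rk e) with hP
      have hPne : P.Nonempty := by
        obtain ⟨e, he, hlt⟩ := htop
        exact ⟨e, Finset.mem_filter.2 ⟨he, hlt⟩⟩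
      obtain ⟨eS, heSP, hSmin⟩ := P.exists_min_image rk hPne
      obtain ⟨heS, hSlt⟩ := Finset.mem_filter.1 heSP
      have hcons : ∀ e ∈ F, rk e ≤ rk eV ∨ rk eS ≤ rk e := fun e he ↦ by
        by_cases h : rk eV < rk e
        · exact Or.inr (hSmin e (Finset.mem_filter.2 ⟨he, h⟩))
        · exact Or.inl (not_lt.1 h)
      refine ⟨eS, heS, fun hS𝒩 ↦ ?_, hSlt, hcons⟩
      -- `eS ∈ 𝒩` would extend the run
      have heSS : eS ∈ S := by
        refine Finset.mem_filter.2 ⟨hS𝒩, fun e' he' h1 h2 ↦ ?_⟩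
        rcases hcons e' he' with h | h
        · exact hrun e' he' h1 h
        · have : rk e' = rk eS := le_antisymm h2 h
          rw [hinj (Finset.mem_coe.2 he') (Finset.mem_coe.2 heS) this]
          exact hS𝒩
      exact absurd (hVmax eS heSS) (not_le.2 hSlt)

end NeckBridge

/-! ## §2 The crossing clusters of a node on `𝕋` -/

section NodeClusters

variable {ℓ lam s : ℕ} {x o : Site 2} {η : SiteConfig (Site 2)}

/-- An endpoint of a virtual edge is within `2ℓ + 1` of its locale. -/
theorem NeckCoarse.triNorm_endpoint_sub_le (hℓ : 1 ≤ ℓ) {e : Site 2 × Site 2} (he : e ∈ vEdges ℓ lam s x o η)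
    {y : Site 2} (hy : y = e.1 ∨ y = e.2) (w : Site 2) : triNorm (y - w) ≤ triNorm (e.2 - w) + (2 * ℓ + 1) ∧
      triNorm (e.2 - w) ≤ triNorm (y - w) + (2 * ℓ + 1) := by
  rcases hy with rfl | rfl
  · have h1 := triNorm_sub_le_of_mem_vEdges hℓ (show (e.1, e.2) ∈ vEdges ℓ lam s x o η from he)
    have h2 := triNorm_sub_le_triNorm_sub_add e.1 e.2 w
    have h3 := triNorm_sub_le_triNorm_sub_add e.2 e.1 w
    have h4 : triNorm (e.2 - e.1) = triNorm (e.1 - e.2) := by rw [← triNorm_neg, neg_sub]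
    constructor <;> omega
  · constructor <;> omega

/-- **The crossing clusters of a node, read off the necklace (registered helper, anchor of this module on the crux item).**
Under the necklace clauses of `tCovering_A_chain` (crossings `b, b'`, family `F ⊆ vEdges`, rank `rk` injective on `F`,
endpoints `inP/outP`, `b ⟶ inP e_min`, `outP e ⟶ inP e'` for rank-consecutive `e, e'`, `outP e_max ⟶ b'`, `b ≁ outP e`,
`outP e ≁ outP e'` for `rk e < rk e'`, all inside `Λ_{2s}(x)`): for every nonempty `𝒩 ⊆ F`, inner-layer centre `w` with the
locales of `𝒩` inside `Λ_Δ(w)` and those of `F ∖ 𝒩` outside `Λ_{Γ-1}(w)`, and radii `Δ + 2ℓ + 2 ≤ r ≤ R`, `R + 2ℓ + 2 ≤ Γ`,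
`R + 2 ≤ s`, there are representatives `uU` (`= b`, or `= outP e` for some `e ∈ F ∖ 𝒩`) and `uV` (`= outP e` for some
`e ∈ 𝒩`), not joined inside `Λ_{2s}(x)`, and open crossings `p₁ → q₁`, `p₂ → q₂` of `tAnn w r R` not joined inside the
annulus, with `uU ⟶ p₁` and `uV ⟶ p₂` inside `Λ_{2s}(x)`. -/
theorem tChain_node_clusters : ∀ (ℓ lam s : ℕ) (x o : Site 2) (η : SiteConfig (Site 2)) (b b' : Site 2) (F : Finset (Site 2 × Site 2)) (rk : Site 2 × Site 2 → ℕ) (inP outP : Site 2 × Site 2 → Site 2), 1 ≤ ℓ → IsCrossing triGraph (tColourGraph η true) (tBall x s) (tBall x (2 * s)) b → IsCrossing triGraph (tColourGraph η true) (tBall x s) (tBall x (2 * s)) b' → ↑F ⊆ vEdges ℓ lam s x o η → Set.InjOn rk ↑F → (∀ e ∈ F, (inP e, outP e) = e ∨ (outP e, inP e) = e) → (∀ e ∈ F, (∀ e' ∈ F, rk e ≤ rk e') → PathIn (tColourGraph η true) (tBall x (2 * s)) b (inP e)) → (∀ e ∈ F, (∀ e' ∈ F, rk e' ≤ rk e)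 → PathIn (tColourGraph η true) (tBall x (2 * s)) (outP e) b') → (∀ e ∈ F, ∀ e' ∈ F, rk e < rk e' → (∀ e'' ∈ F, rk e'' ≤ rk e ∨ rk e' ≤ rk e'') → PathIn (tColourGraph η true) (tBall x (2 * s)) (outP e) (inP e')) → (∀ e ∈ F, ¬ PathIn (tColourGraph η true) (tBall x (2 * s)) b (outP e)) → (∀ e ∈ F, ∀ e' ∈ F, rk e < rk e' → ¬ PathIn (tColourGraph η true) (tBall x (2 * s)) (outP e) (outP e')) → ∀ 𝒩 ⊆ F, 𝒩.Nonempty → ∀ (w : Site 2) (Δ r R Γ : ℕ), w ∈ innerLayer triGraph (tBall x s) (tBall x (2 * s)) → (∀ e ∈ 𝒩, triNorm (e.2 - w) ≤ Δ) → (∀ e ∈ F, e ∉ 𝒩 → (Γ : ℤ) ≤ triNorm (e.2 - w)) → Δ + 2 * ℓ + 2 ≤ r → r ≤ R → R + 2 * ℓ + 2 ≤ Γ → R + 2 ≤ s → ∃ uU uV : Site 2, (uU = b ∨ ∃ e ∈ F, e ∉ 𝒩 ∧ uU = outP e) ∧ (∃ e ∈ 𝒩, uV = outP e) ∧ ¬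 PathIn (tColourGraph η true) (tBall x (2 * s)) uU uV ∧ ∃ p₁ q₁ p₂ q₂ : Site 2, triNorm (p₁ - w) = r ∧ triNorm (q₁ - w) = R ∧ triNorm (p₂ - w) = r ∧ triNorm (q₂ - w) = R ∧ PathIn (tColourGraph η true) (tAnn w r R) p₁ q₁ ∧ PathIn (tColourGraph η true) (tAnn w r R) p₂ q₂ ∧ ¬ PathIn (tColourGraph η true) (tAnn w r R) p₁ p₂ ∧ PathIn (tColourGraph η true) (tBall x (2 * s)) uU p₁ ∧ PathIn (tColourGraph η true) (tBall x (2 * s)) uV p₂ := by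
  intro ℓ lam s x o η b b' F rk inP outP hℓ hb hb' hFU hinj hor hbmin hbmax hcons hb0 hlt 𝒩 h𝒩 hne w Δ r R Γ hw hΔ hΓ
    hr hrR hRΓ hRs
  classical
  set O := tBall x (2 * s) with hO
  set H := tColourGraph η true with hH
  obtain ⟨e₁, he₁, eV, heV, h1V, hmin, hrun, hpred, hsucc⟩ := NeckBridge.exists_firstRun h𝒩 hne rk hinj
  have he₁F : e₁ ∈ F := h𝒩 he₁
  have heVF : eV ∈ F := h𝒩 heV
  -- endpoints are endpoints
  have hends : ∀ e ∈ F, (inP e = e.1 ∨ inP e = e.2) ∧ (outP e = e.1 ∨ outP e = e.2) := by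
    intro e he
    rcases hor e he with h | h
    · exact ⟨Or.inl (congrArg Prod.fst h), Or.inr (congrArg Prod.snd h)⟩
    · exact ⟨Or.inr (congrArg Prod.snd h), Or.inl (congrArg Prod.fst h)⟩
  -- near points
  have hnear : ∀ e ∈ 𝒩, ∀ y, (y = e.1 ∨ y = e.2) → triNorm (y - w) < r := by
    intro e he y hy
    have h1 := (NeckCoarse.triNorm_endpoint_sub_le hℓ (hFU (h𝒩 he)) hy w).1
    have h2 := hΔ e he
    omega
  -- far points
  have hfarE : ∀ e ∈ F, e ∉ 𝒩 → ∀ y, (y = e.1 ∨ y = e.2) → (R : ℤ) ≤ triNorm (y - w) := by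
    intro e he hen y hy
    have h1 := (NeckCoarse.triNorm_endpoint_sub_le hℓ (hFU he) hy w).2
    have h2 := hΓ e he hen
    omega
  have hfarC : ∀ {c : Site 2}, IsCrossing triGraph H (tBall x s) O c → ∃ q, PathIn H O c q ∧ (R : ℤ) ≤ triNorm (q - w) := by
    rintro c ⟨-, q, hqo, hpq⟩
    refine ⟨q, hpq.mono Set.sdiff_subset, ?_⟩
    have h1 := le_triNorm_of_mem_outerLayer hqo
    have h2 := triNorm_le_of_mem_innerLayer hw
    have h3 := triNorm_sub_le_triNorm_sub_add q w x
    push_cast at h1 hRs ⊢; omega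
  -- the `U`-side: a path inside `O` from the near point `inP e₁` to a far point, through `uU`
  have hU : ∃ uU, (uU = b ∨ ∃ e ∈ F, e ∉ 𝒩 ∧ uU = outP e) ∧ (uU = b ∨ ∃ e ∈ F, uU = outP e ∧ rk e < rk eV) ∧
      PathIn H O uU (inP e₁) ∧ ∃ q, PathIn H O uU q ∧ (R : ℤ) ≤ triNorm (q - w) := by
    rcases hpred with hbot | ⟨eU, heU, heU𝒩, hUlt, hUcons⟩
    · obtain ⟨q, hbq, hq⟩ := hfarC hb
      exact ⟨b, Or.inl rfl, Or.inl rfl, hbmin e₁ he₁F hbot, q, hbq, hq⟩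
    · refine ⟨outP eU, Or.inr ⟨eU, heU, heU𝒩, rfl⟩, Or.inr ⟨eU, heU, rfl, hUlt.trans_le h1V⟩,
        hcons eU heU e₁ he₁F hUlt hUcons, outP eU, PathIn.refl ?_, hfarE eU heU heU𝒩 _ (hends eU heU).2⟩
      exact (mem_tBall_of_mem_vEdges (hFU heU)).elim (fun h1 h2 ↦ by
        rcases (hends eU heU).2 with h | h <;> rw [h] <;> assumption)
  -- the `V`-side: from the near point `outP eV` to a far point
  have hV : ∃ q, PathIn H O (outP eV) q ∧ (R : ℤ) ≤ triNorm (q - w) := by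
    rcases hsucc with htop | ⟨eS, heS, heS𝒩, hSlt, hScons⟩
    · obtain ⟨q, hb'q, hq⟩ := hfarC hb'
      exact ⟨q, (hbmax eV heVF htop).trans hb'q, hq⟩
    · exact ⟨inP eS, hcons eV heVF eS heS hSlt hScons, hfarE eS heS heS𝒩 _ (hends eS heS).1⟩
  obtain ⟨uU, hUrep, hUrk, hUin, qU, hUq, hqU⟩ := hU
  obtain ⟨qV, hVq, hqV⟩ := hV
  -- distinctness of the two clusters inside `O`
  have hUV : ¬ PathIn H O uU (outP eV) := by
    rcases hUrk with rfl | ⟨e, he, rfl, hlt'⟩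
    · exact hb0 eV heVF
    · exact hlt e he eV heVF hlt'
  -- crossings
  obtain ⟨p₁, q₁, hp₁, hq₁, hcross₁, hUp₁⟩ := exists_crossing_of_pathIn hrR
    (hnear e₁ he₁ _ (hends e₁ he₁F).1) hqU ((PathIn.symm hUin).trans hUq)
  obtain ⟨p₂, q₂, hp₂, hq₂, hcross₂, hVp₂⟩ := exists_crossing_of_pathIn hrR
    (hnear eV heV _ (hends eV heVF).2) hqV hVq
  refine ⟨uU, outP eV, hUrep, ⟨eV, heV, rfl⟩, hUV, p₁, q₁, p₂, q₂, hp₁, hq₁, hp₂, hq₂,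
    hcross₁.mono inter_subset_right, hcross₂.mono inter_subset_right, fun h12 ↦ hUV ?_, hUin.trans hUp₁, hVp₂⟩
  exact (hUin.trans hUp₁).trans ((h12.mono (tAnn_subset_tBall hw (by omega))).trans (PathIn.symm hVp₂))

end NodeClusters

end Summit.CriticalPhenomena.CardyFormulaZ2.Cruxes.NestingRigidity.PinchResampling

end
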